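import Mathlib
import Literature.MathematicalPhysics.QuantumManyBody.PeriodicBoseGas
import Literature.MathematicalPhysics.QuantumManyBody.PeriodicBoseGasFourier

/-!
# Sketch — crux-ideate stmt-AtomisticToContinuum-3972 (`PeriodicIRBound`), round 1, ideator 2

First lemmas of the two crux ideas filed from this seat (statements only; they must elaborate):

* `GramPencilTangency` — card `gram-pencil-tangency`: at mean-field closure the level-1 Gram
  matrix of the two condensate-transfer generators and their commutator pencil are feasible
  together ONLY at Bogoliubov's point `2n+1 = A/ε`, in particular `n ≤ (A-ε)/(2ε) = v_k²`.
* `GramPencilTolerance` — card `gram-pencil-tangency` (robust half): the same conclusion with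
  the pencil entries carrying errors `e₁ e₂ e₃`; the bound on `s = 2n+1` it yields shows which
  error combination must be small to which order (`E - ε` below: linear tolerance on `e₁ - e₂`,
  quadratic only on the gap combination `A(e₁+e₂) + 2Be₃`).
* `ZeroModeDeletionPin` — card `gram-pencil-tangency` (the `k = 0` member of its weighted
  coherences, typed): the canonical, one-sided Hugenholtz–Pines / Stringari (35) pin: deleting a
  zero-mode particle from the exact `(N+1)`-particle torus minimiser and using it as an
  `N`-particle trial state bounds the potential-weighted zero-mode coherence by
  `μ_N = E₀(N+1) - E₀(N)` times the zero-mode weight.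
* `PhaseExtraction` — card `fsum-phase-pencil`: the arithmetic from the five measured numbers of
  the `{ρ_k, Y_k}` pencil (f-sum entry `F = N k²`, phase double commutator `𝒴`, exact kinematic
  split of the mixed entry `m = -k² N₀ π + m_inc`) to the bound on the phase-quadrature
  fluctuation `π ∋ 2 n_k`: `π ≤ √(N 𝒴)/(N₀ k) + |m_inc|/(N₀ k²)` — no `(kξ)²` precision anywhere.
-/

noncomputable section

open MeasureTheory
open scoped ENNReal ComplexConjugate

namespace Summit.AtomisticToContinuum.BoseEinsteinCondensation.Cruxes.PeriodicIRBound.Ideator2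

open Literature.MathematicalPhysics.QuantumManyBody.BoseGas

/-- **Gram–pencil tangency (exact, mean-field entries).** Data: `A = k² + B > B > 0`
(`B = 8πρa`-type pairing coefficient), `ε = √(A² - B²)` (Bogoliubov energy); unknowns: the
occupation `n = n_k ≥ 0` and the (real) pairing amplitude `p = -⟨a_k a_{-k}⟩`.
Hypotheses: (Gram) `p² ≤ n(n+1)` — positivity of the `2×2` moment matrix of
`{a₀†a_k, a_{-k}†a₀}`, exact kinematics; (Pencil) positivity of the `2×2` commutator pencil
`⟨X†[H,X]⟩ ≥ 0`, `X = α a₀†a_k + β a_{-k}†a₀`, whose mean-field matrix is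
`[[Bp - An, -B/2], [-B/2, A(n+1) - Bp]]`.
Conclusion: `2n + 1 = A/ε` (so `n = (A-ε)/(2ε) = v_k²` exactly: the two cones are TANGENT at
Bogoliubov's point). Two-line proof: `(Bp-An)(A(n+1)-Bp) = ¼[A² - (A(2n+1) - 2Bp)²]`, so the
determinant condition reads `|A s - 2Bp| ≤ ε` (`s = 2n+1`); squaring `2Bp ≥ As - ε` and using
`4B²p² ≤ B²(s²-1)` gives `(ε s - A)² ≤ 0`. [folklore; card gram-pencil-tangency] -/
def GramPencilTangency : Prop :=
  ∀ A B n p : ℝ, 0 < B → B < A → 0 ≤ n →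
    p ^ 2 ≤ n * (n + 1) →
    0 ≤ B * p - A * n →
    0 ≤ A * (n + 1) - B * p →
    (B / 2) ^ 2 ≤ (B * p - A * n) * (A * (n + 1) - B * p) →
    2 * n + 1 = A / Real.sqrt (A ^ 2 - B ^ 2)

/-- **Gram–pencil tolerance (robust version).** Same data; now the three pencil entries carry
errors `e₁, e₂` (diagonal) and `e₃` (off-diagonal): the matrix
`[[Bp - An + e₁, -B/2 + e₃], [-B/2 + e₃, A(n+1) - Bp + e₂]]` is positive semidefinite, the Gram
inequality stays exact. Put `ε² = A² - B²`, `ε'² = (A + e₁ + e₂)² - (B - 2e₃)²` and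
`E = (e₁ - e₂) + ε'`. Conclusion: if `ε ≤ E` then `ε²(2n+1) ≤ A E + B √(E² - ε²)`.
Reading (the point of the card): `E - ε ≈ (e₁ - e₂) + [A(e₁+e₂) + 2B e₃]/ε`; the bound stays
within a factor `2` of Bogoliubov's `A/ε` as long as `E - ε ≲ ε·A²/(2B²)`, i.e. the ANTISYMMETRIC
error `e₁ - e₂` is tolerated at the linear scale `ε ~ c|k|` while only the GAP combination
`A(e₁+e₂) + 2Be₃` (the error in `A² - B²`, Hugenholtz–Pines-protected) must be `O(ε²) ~ k²`.
[folklore; card gram-pencil-tangency] -/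
def GramPencilTolerance : Prop :=
  ∀ A B n p e₁ e₂ e₃ : ℝ, 0 < B → B < A → 0 ≤ n →
    p ^ 2 ≤ n * (n + 1) →
    0 ≤ B * p - A * n + e₁ →
    0 ≤ A * (n + 1) - B * p + e₂ →
    (B / 2 - e₃) ^ 2 ≤ (B * p - A * n + e₁) * (A * (n + 1) - B * p + e₂) →
    let ε := Real.sqrt (A ^ 2 - B ^ 2)
    let ε' := Real.sqrt ((A + e₁ + e₂) ^ 2 - (B - 2 * e₃) ^ 2)
    let E := (e₁ - e₂) + ε'
    ε ≤ E →
    ε ^ 2 * (2 * n + 1) ≤ A * E + B * Real.sqrt (E ^ 2 - ε ^ 2)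

/-- The zero-mode deletion of an `(N+1)`-particle wave function: integrate the first particle
over the cell, `φ(X) = ∫_{[0,L)³} Ψ(y, X) dy` (`X ∈ ([0,L)³)^N`); up to the factor `L^{-3/2}` this
is `a₀ Ψ` in first quantisation. [cite: Stringari1995, §3 (34)–(35)] -/
def zeroModeDeletion {N : ℕ} (L : ℝ) (Ψ : Config (N + 1) → ℂ) (X : Config N) : ℂ :=
  ∫ y in cell L, Ψ (Matrix.vecCons y X)

/-- The potential-weighted zero-mode deletion `w(X) = ∫_{[0,L)³} U_X(y) Ψ(y, X) dy`,
`U_X(y) = ∑ⱼ v^per(xⱼ - y)` the potential the deleted particle feels from the others (hard cores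
enter through `toReal`, i.e. the statement below is aimed at bounded `v`; for `v` with hard core
the integrand vanishes where `U = ⊤` for finite-energy `Ψ`). This is the `k = 0` member of the
family of potential-weighted coherences that are the interaction entries of the Gram–pencil
certificate (Stringari's `W(q)` at `q = 0`). [cite: Stringari1995, §3 (35), (41)–(42)] -/
def weightedZeroModeDeletion {N : ℕ} (v : ℝ → ℝ≥0∞) (L : ℝ) (Ψ : Config (N + 1) → ℂ)
    (X : Config N) : ℂ :=
  ∫ y in cell L, ((∑ j : Fin N, periodizedPotential v L (X j - y)).toReal : ℂ) *
    Ψ (Matrix.vecCons y X)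

/-- **Zero-mode deletion pin (canonical, one-sided Hugenholtz–Pines / Stringari (34)–(36)).**
For an exact periodic minimiser `Ψ` of `N+1` bosons on the torus of side `L` (finite energies),
the deleted function `φ = zeroModeDeletion L Ψ.ψ` is an `N`-particle trial function with
`𝓠_N(φ) = E₀(N+1)‖φ‖² - Re⟨φ, w⟩` (weak Euler–Lagrange equation tested against `η ⊗ 1`, the
deleted particle carrying no kinetic energy), hence by the variational principle
`Re⟨φ, w⟩ ≤ (E₀(N+1) - E₀(N)) ‖φ‖²`: the potential felt by a zero-momentum-projected particle,
weighted by the zero-mode amplitude, is at most the chemical potential `μ_N` times the zero-mode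
weight `‖φ‖² = L³·⟨Ψ, P₀^{(1)} Ψ⟩`. For a positive minimiser both sides are non-negative. This pins
the `k → 0` end of the renormalised pencil coefficients (`A_r(0) - B_r(0) = 0`).
[cite: Stringari1995, §3 (34)–(36)] -/
def ZeroModeDeletionPin : Prop :=
  ∀ (v : ℝ → ℝ≥0∞) (N : ℕ) (L : ℝ), 0 < L →
    periodicGroundStateEnergy v N L ≠ ⊤ →
    periodicGroundStateEnergy v (N + 1) L ≠ ⊤ →
    ∀ Ψ : PeriodicTrialState (N + 1) L,
      periodicEnergy v Ψ = periodicGroundStateEnergy v (N + 1) L →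
      (∫ X in cellN N L,
          (conj (zeroModeDeletion L Ψ.ψ X) * weightedZeroModeDeletion v L Ψ.ψ X)).re ≤
        ((periodicGroundStateEnergy v (N + 1) L).toReal -
            (periodicGroundStateEnergy v N L).toReal) *
          ∫ X in cellN N L, ‖zeroModeDeletion L Ψ.ψ X‖ ^ 2

/-- **Phase extraction (card `fsum-phase-pencil`).** In the ground-state cone the `2×2` matrix
`[[F, m], [m, 𝒴]]` of `(H-E₀)`-moments of the pair (density wave `ρ_k`, condensate phase-transfer
`Y_k = a₀†a_k - a₋ₖ†a₀`) is positive semidefinite (Cauchy–Schwarz for `(H-E₀)^{1/2}ρ_kΨ₀`,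
`(H-E₀)^{1/2}Y_kΨ₀`). Its entries: `F = ⟨ρ_k†(H-E₀)ρ_k⟩ = N k²` EXACTLY (f-sum rule, units
`ħ = 2m = 1`); `𝒴 = ⟨Y†(H-E₀)Y⟩ = ½⟨[Y†,[H,Y]]⟩` an explicit double commutator (by inversion
symmetry), `≈ N₀(k² + 2B)`; and — the lever — the mixed entry is purely kinetic because `V`
commutes with `ρ_k`: `m = -⟨[T, ρ_k†] Y_k⟩ = -k² ⟨Y_k†Y_k⟩ + m_inc`, the condensate terms of
`[T, ρ_k†] = Σ_p (2p·k - k²) a_p†a_{p-k}` being exactly `k² Y_k†`, the rest (`p ∉ {0, k}`, the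
non-condensate longitudinal current) defining `m_inc`. With `π := ⟨Y†Y⟩/N₀ ∋ 2n_k` the
determinant condition `m² ≤ F 𝒴` becomes the stated bound; at Bogoliubov level
(`m_inc = 0`, `𝒴 = N₀(A+B)`, `N = N₀`) it is SATURATED: `π = √(A+B)/k = (A+B)/ε_k`.
[folklore; card fsum-phase-pencil] -/
def PhaseExtraction : Prop :=
  ∀ N N₀ k F Yd pi minc : ℝ, 0 < k → 0 < N₀ → 0 ≤ N → 0 ≤ Yd → 0 ≤ pi →
    F = N * k ^ 2 →
    (k ^ 2 * N₀ * pi - minc) ^ 2 ≤ F * Yd →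
    pi ≤ Real.sqrt (N * Yd) / (N₀ * k) + |minc| / (N₀ * k ^ 2)

end Summit.AtomisticToContinuum.BoseEinsteinCondensation.Cruxes.PeriodicIRBound.Ideator2

end
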